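import Mathlib.RepresentationTheory.Homological.GroupCohomology.Shapiro
import Mathlib.RepresentationTheory.Homological.GroupCohomology.Functoriality
import HarnessLib

/-!
# Mathlib's Shapiro isomorphism is restriction followed by evaluation

Topic `Algebra/Homology`; namespace `Literature.Algebra.Homology`.  Mathlib only; definitions with
bodies and theorems (no named fact).

Mathlib's Shapiro isomorphism `groupCohomology.coindIso A n : Hⁿ(G, Coind_S^G A) ≅ Hⁿ(S, A)`
(`S ≤ G`, `A` an `S`-representation) is constructed abstractly from `Ext`-isomorphisms through the
bar resolution of `G` restricted to `S`.  We prove that it is the classical map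
(`coindIso_hom_eq`):

  `coindIso A n = Hⁿ(S ↪ G, ev₁) = groupCohomology.map S.subtype (coindCounit S A) n`,

restriction to `S` followed by the counit `ev₁ : Coind_S^G(A)|_S → A`, `f ↦ f(1)`
[Brown, *Cohomology of Groups*, III (6.2) and Ex. III.8.2].  In particular this explicit map is an
isomorphism (`isIso_map_subtype_coindCounit`, `map_subtype_coindCounit_injective`), which is what
makes Hecke-type operators computable through Shapiro's lemma.

Ingredients:
* `isoExt_hom_comp_homologyMap_precomp` — **change of resolution for `ProjectiveResolution.isoExt`**:
  for a chain map `φ : P → Q` of projective resolutions of `X` compatible with the augmentations,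
  `isoExt Q ≫ Hⁿ(Hom(φ, Y)) = isoExt P` (Mathlib `isoLeftDerivedObj_inv_naturality` + naturality of
  `homologyOp`);
* `barInclusion S : bar_S ⟶ res_S(bar_G)` — the inclusion of bar resolutions (generators to
  generators), a chain map compatible with the augmentations (`barInclusion_f_zero_comp_π`, using the
  formula `diagonalSuccIsoFree_inv_hom_single_single` for Mathlib's `k[Gⁿ⁺¹] ≅ Gⁿ →₀ k[G]`);
* `cochainsMap_coindCounit_comp_iso_hom` — on inhomogeneous cochains, restriction-and-evaluation is
  `C•(G, Coind A) ≅ Hom(bar_G, Coind A) ≅ Hom(res bar_G, A) → Hom(bar_S, A) ≅ C•(S, A)`.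

## References

* K. S. Brown, *Cohomology of Groups*, GTM 87 (1982), III §5–§6 (6.2), §8 Ex. 2.
  [Brown1982CohomologyGroups]
* C. A. Weibel, *An introduction to homological algebra* (1994), Lemma 6.3.2, §2.4. [Weibel1994]
-/

noncomputable section

open CategoryTheory CategoryTheory.Limits groupCohomology Opposite Finsupp

universe w v u

namespace Literature.Algebra.Homology


/-! ### Change of resolution for `isoExt` -/

section Ext

variable {R : Type w} [Ring R] {C : Type u} [Category.{v} C] [Abelian C] [Linear R C]
  {X : C} (P Q : ProjectiveResolution X)

/-- Precomposition with a chain map `φ : P ⟶ Q` of resolutions on the complexes `Hom(-, Y)`: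
`Hom(Q, Y) ⟶ Hom(P, Y)`. [folklore] -/
noncomputable def precompYoneda (φ : P.complex ⟶ Q.complex) (Y : C) :
    Q.complex.linearYonedaObj R Y ⟶ P.complex.linearYonedaObj R Y :=
  (HomologicalComplex.unopFunctor (ModuleCat R) (ComplexShape.down ℕ)).map
    ((((linearYoneda R C).obj Y).rightOp.mapHomologicalComplex (ComplexShape.down ℕ)).map φ).op

/-- In each degree `precompYoneda` is `f ↦ φ_i ≫ f`. [folklore] -/
theorem precompYoneda_f_apply (φ : P.complex ⟶ Q.complex) (Y : C) (i : ℕ) (f : Q.complex.X i ⟶ Y) :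
    ((precompYoneda (R := R) P Q φ Y).f i).hom f = φ.f i ≫ f := rfl

variable [EnoughProjectives C]

/-- **Change of resolution for `isoExt`**: for a chain map `φ : P ⟶ Q` of projective resolutions of
`X` compatible with the augmentations in degree `0`, Mathlib's `Extⁿ(X, Y) ≅ Hⁿ(Hom(Q, Y))` followed by
`Hⁿ(Hom(φ, Y))` is `Extⁿ(X, Y) ≅ Hⁿ(Hom(P, Y))`. [cite: Weibel1994, §2.4 (Comparison Theorem 2.2.6, 2.4.1)] -/
theorem isoExt_hom_comp_homologyMap_precomp (φ : P.complex ⟶ Q.complex)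
    (comm : φ.f 0 ≫ Q.π.f 0 = P.π.f 0) (n : ℕ) (Y : C) :
    (Q.isoExt n Y).hom ≫ HomologicalComplex.homologyMap (precompYoneda (R := R) P Q φ Y) n =
      (P.isoExt n Y).hom := by
  have hnat := ProjectiveResolution.isoLeftDerivedObj_inv_naturality (𝟙 X) P Q φ
    (comm.trans (Category.comp_id _).symm) ((linearYoneda R C).obj Y).rightOp n
  rw [CategoryTheory.Functor.map_id, Category.comp_id] at hnat
  simp only [ProjectiveResolution.isoExt, Iso.trans_hom, Iso.symm_hom, Iso.unop_inv, Category.assoc]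
  rw [hnat]
  apply Quiver.Hom.op_inj
  simp only [op_comp, Category.assoc, HomologicalComplex.homologyUnop, Iso.unop_inv]
  set L := ((linearYoneda R C).obj Y).rightOp with hL
  change (HomologicalComplex.homologyMap (precompYoneda P Q φ Y) n).op ≫
      (((L.mapHomologicalComplex (ComplexShape.down ℕ)).obj Q.complex).unop.homologyOp n).inv ≫
        (Q.isoLeftDerivedObj L n).inv =
    (((L.mapHomologicalComplex (ComplexShape.down ℕ)).obj P.complex).unop.homologyOp n).inv ≫
      (L.mapHomologicalComplex (ComplexShape.down ℕ) ⋙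
          HomologicalComplex.homologyFunctor (ModuleCat R)ᵒᵖ (ComplexShape.down ℕ) n).map φ ≫
        (Q.isoLeftDerivedObj L n).inv
  simp only [← Category.assoc]
  congr 1
  have h2 := (HomologicalComplex.homologyOp_hom_naturality (precompYoneda (R := R) P Q φ Y) n).symm
  exact (Iso.eq_inv_comp _).mpr ((Iso.comp_inv_eq _).mpr h2)

end Ext

/-! ### The inclusion of bar resolutions -/

section Bar

variable {k G : Type u} [CommRing k] [Group G] (S : Subgroup G)

/-- The bar resolution of `G` restricted to `S`, a projective resolution of the trivial
representation of `S` (the resolution through which Mathlib's `coindIso` is built). [folklore] -/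
noncomputable abbrev resBar : ProjectiveResolution (Rep.trivial k S k) :=
  (Rep.resFunctor S.subtype).mapProjectiveResolution (Rep.barResolution k G)

/-- The degree-`n` inclusion `Sⁿ →₀ k[S] ⟶ (Gⁿ →₀ k[G])|_S`, generators to generators. [folklore] -/
noncomputable def barInclusionF (n : ℕ) :
    Rep.free k S (Fin n → S) ⟶ Rep.res S.subtype (Rep.free k G (Fin n → G)) :=
  Rep.freeLift k S (Rep.res S.subtype (Rep.free k G (Fin n → G))) fun y =>
    single (fun i => (y i : G)) (MonoidAlgebra.single (1 : G) (1 : k))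

/-- `barInclusionF` on basis elements. [folklore] -/
theorem barInclusionF_hom_single_single {n : ℕ} (y : Fin n → S) (s : S) (r : k) :
    (barInclusionF (k := k) S n).hom (single y (MonoidAlgebra.single s r)) =
      single (fun i => (y i : G)) (MonoidAlgebra.single (s : G) r) := by
  rw [barInclusionF, Rep.hom_ofHom, Representation.freeLift_single_single]
  change r • Representation.free k G (Fin n → G) (s : G) _ = _
  rw [Representation.free_single_single, mul_one, smul_single, MonoidAlgebra.smul_single', mul_one]

omit [CommRing k] in
/-- Contracting adjacent entries commutes with the coercion `S → G`. [folklore] -/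
theorem contractNth_coe {n : ℕ} (j : Fin (n + 1)) (y : Fin (n + 1) → S) :
    Fin.contractNth j (· * ·) (fun i => (y i : G)) = fun i => ((Fin.contractNth j (· * ·) y) i : G) :=
  (Fin.comp_contractNth (· * ·) (· * ·) (f := fun s : S => (s : G)) (fun _ _ => rfl) j y).symm

/-- **The inclusion of bar resolutions** `bar_S ⟶ res_S(bar_G)` is a chain map. [folklore] -/
noncomputable def barInclusion : Rep.barComplex k S ⟶ (resBar (k := k) S).complex :=
  ChainComplex.ofHom (fun n => barInclusionF S n) fun n => by
    change barInclusionF S (n + 1) ≫ (Rep.resFunctor S.subtype).map ((Rep.barComplex k G).d (n + 1) n) =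
      (Rep.barComplex k S).d (n + 1) n ≫ barInclusionF S n
    rw [Rep.barComplex.d_def, Rep.barComplex.d_def]
    refine Rep.free_ext _ _ _ _ _ fun y => ?_
    rw [Rep.hom_comp, Rep.hom_comp, Representation.IntertwiningMap.comp_apply,
      Representation.IntertwiningMap.comp_apply]
    change (Rep.barComplex.d k G n).hom ((barInclusionF S (n + 1)).hom (single y (MonoidAlgebra.single 1 1))) = _
    rw [barInclusionF_hom_single_single, OneMemClass.coe_one, Rep.barComplex.d_single,
      Rep.barComplex.d_single, map_add, map_sum]
    congr 1
    · rw [barInclusionF_hom_single_single]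
    · refine Finset.sum_congr rfl fun j _ => ?_
      rw [barInclusionF_hom_single_single, OneMemClass.coe_one, contractNth_coe]

/-- Components of `barInclusion`. [folklore] -/
theorem barInclusion_f (n : ℕ) : (barInclusion (k := k) S).f n = barInclusionF S n := rfl

set_option backward.defeqAttrib.useBackward true in
set_option backward.isDefEq.respectTransparency false in
/-- The inverse of Mathlib's `k[Gⁿ⁺¹] ≅ (Gⁿ →₀ k[G])` on basis elements:
`single f (single g r) ↦ single (g • partialProd f) r` (Mathlib proves this privately inside
`Rep.barComplex.d_comp_diagonalSuccIsoFree_inv_eq`). [folklore] -/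
theorem diagonalSuccIsoFree_inv_hom_single_single (m : ℕ) (f : Fin m → G) (g : G) (r : k) :
    (Rep.diagonalSuccIsoFree k G m).inv.hom (single f (MonoidAlgebra.single g r)) =
      MonoidAlgebra.single (g • Fin.partialProd f) r := by
  simp only [Rep.diagonalSuccIsoFree, Rep.diagonalSuccIsoTensorTrivial, Iso.trans_inv, Rep.hom_comp,
    Representation.IntertwiningMap.comp_apply]
  have step1 : (Rep.Hom.hom (Rep.leftRegularTensorTrivialIsoFree k G (Fin m → G)).inv)
      (single f (.single g r)) = .single g 1 ⊗ₜ[k] .single f r :=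
    Representation.leftRegularTensorTrivialIsoFree_symm_apply_single_single f g r
  rw [step1]
  simp only [Rep.mkIso_inv, Representation.linearizeOfMulActionIso, Representation.Equiv.mk_symm,
    LinearEquiv.refl_symm, ConcreteCategory.hom_ofHom, Action.tensorObj_V,
    Functor.mapIso_inv, Rep.tensor_V, Rep.tensor_ρ, Iso.symm_inv, Functor.Monoidal.μIso_hom, Rep.μ_hom,
    MonoidalCategory.tensorIso_inv, Representation.linearizeTrivialIso, Rep.hom_tensorHom,
    Representation.IntertwiningMap.tensor_apply, Representation.Equiv.coe_toIntertwiningMap,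
    Representation.Equiv.mk_apply, LinearEquiv.refl_apply]
  have key₁ := Representation.linearizeMap_single (k := k)
    (Action.diagonalSuccIsoTensorTrivial G m).inv (g, f) ((1 : k) * r)
  have key₂ := Representation.LinearizeMonoidal.μ_apply_single_single (k := k)
    (X := Action.leftRegular G) (Y := Action.trivial G (Fin m → G)) g f 1 r
  exact ((congrArg (fun z => (Representation.linearizeMap
    (Action.diagonalSuccIsoTensorTrivial G m).inv) z) key₂).trans key₁).trans (by simp)

/-- Restriction does not change underlying maps. [folklore] -/
theorem resMap_hom_apply {H : Type u} [Group H] (f : H →* G) {X Y : Rep.{u} k G} (p : X ⟶ Y) (x : X) :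
    (Rep.resMap f p).hom x = p.hom x := rfl

omit [Group G] in
/-- The augmentation `k[G¹] → k` on basis elements. [folklore] -/
theorem ε_hom_single (H : Type u) [Group H] (f : Fin 1 → H) (r : k) :
    (Rep.standardComplex.ε k H).hom (MonoidAlgebra.single f r) = r := by
  simp [Rep.standardComplex.ε]

/-- **`barInclusion` is compatible with the augmentations.** [folklore] -/
theorem barInclusion_f_zero_comp_π :
    (barInclusion (k := k) S).f 0 ≫ (resBar S).π.f 0 = (Rep.barResolution k S).π.f 0 := by
  rw [barInclusion_f]
  simp only [resBar, Functor.mapProjectiveResolution, HomologicalComplex.comp_f,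
    Functor.mapHomologicalComplex_map_f, HomologicalComplex.singleMapHomologicalComplex_hom_app_self,
    Rep.barResolution, Rep.barComplex.isoStandardComplex, HomologicalComplex.Hom.isoOfComponents_hom_f,
    Iso.symm_hom, Rep.standardComplex.εToSingle₀, ChainComplex.toSingle₀Equiv_symm_apply_f_zero]
  refine Rep.free_ext _ _ _ _ _ fun y => ?_
  have h1 : (barInclusionF S 0).hom (single y (MonoidAlgebra.single (1 : S) (1 : k))) =
      single (fun i => (y i : G)) (MonoidAlgebra.single (1 : G) (1 : k)) := by
    rw [barInclusionF_hom_single_single, OneMemClass.coe_one]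
  have h2 : (Rep.standardComplex.ε k G).hom ((Rep.diagonalSuccIsoFree k G 0).inv.hom
      (single (fun i => (y i : G)) (MonoidAlgebra.single (1 : G) (1 : k)))) = 1 := by
    rw [diagonalSuccIsoFree_inv_hom_single_single, ε_hom_single]
  have h3 : (Rep.standardComplex.ε k S).hom ((Rep.diagonalSuccIsoFree k S 0).inv.hom
      (single y (MonoidAlgebra.single (1 : S) (1 : k)))) = 1 := by
    rw [diagonalSuccIsoFree_inv_hom_single_single, ε_hom_single]
  change (HomologicalComplex.singleObjXSelf (ComplexShape.down ℕ) 0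
      (Rep.of (MonoidHom.comp (Representation.trivial k G k) S.subtype))).inv.hom
      ((HomologicalComplex.singleObjXSelf (ComplexShape.down ℕ) 0 (Rep.trivial k G k)).hom.hom
        ((Rep.standardComplex.ε k G).hom ((Rep.diagonalSuccIsoFree k G 0).inv.hom
          ((barInclusionF S 0).hom (single y (MonoidAlgebra.single (1 : S) (1 : k))))))) =
    (Rep.standardComplex.ε k S).hom ((Rep.diagonalSuccIsoFree k S 0).inv.hom
      (single y (MonoidAlgebra.single (1 : S) (1 : k))))
  rw [h1, h2, h3]
  rfl

/-! ### The counit and the identification -/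

variable (B : Rep.{u} k S)

/-- **The counit `ev₁ : Coind_S^G(B)|_S ⟶ B`, `f ↦ f(1)`** of the adjunction `res ⊣ coind`.
[cite: Brown1982CohomologyGroups, III §5–§6] -/
noncomputable def coindCounit : Rep.res S.subtype (Rep.coind S.subtype B) ⟶ B :=
  Rep.ofHom (LinearMap.intertwiningMap_of_isIntertwiningMap _ _
    { toFun := fun f => f.1 1
      map_add' := fun _ _ => rfl
      map_smul' := fun _ _ => rfl }
    fun s f => by
      change f.1 (1 * (s : G)) = B.ρ s (f.1 1)
      have := f.2 s 1
      rw [mul_one] at this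
      rw [one_mul]
      exact this)

/-- Unfolding `coindCounit`. [folklore] -/
@[simp]
theorem coindCounit_hom_apply (f : Rep.coind S.subtype B) : (coindCounit S B).hom f = f.1 1 := rfl

/-- Mathlib's `groupCohomologyIso B n (res bar_G)` followed by `Hⁿ(Hom(barInclusion, B))` is the map
induced by `inhomogeneousCochainsIso B`. [folklore] -/
theorem groupCohomologyIso_resBar_hom_comp (n : ℕ) :
    (groupCohomologyIso B n (resBar S)).hom ≫
        HomologicalComplex.homologyMap (precompYoneda (R := k) (Rep.barResolution k S) (resBar S)
          (barInclusion S) B) n =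
      HomologicalComplex.homologyMap (inhomogeneousCochainsIso B).hom n := by
  rw [groupCohomologyIso, groupCohomologyIsoExt, Iso.trans_hom, Iso.trans_hom, Category.assoc,
    Category.assoc, isoExt_hom_comp_homologyMap_precomp _ _ _ (barInclusion_f_zero_comp_π S),
    Rep.barResolution.extIso, Iso.symm_hom]
  exact (congrArg (fun t => (isoOfQuasiIsoAt (HomotopyEquiv.ofIso (inhomogeneousCochainsIso B)).hom n).hom ≫ t)
    (Iso.inv_hom_id _)).trans (Category.comp_id _)


/-- **Restriction-and-evaluation on cochains** corresponds, under Mathlib's identifications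
`C•(G, Coind B) ≅ Hom(bar_G, Coind B) ≅ Hom(res bar_G, B)`, to precomposition with `barInclusion`.
[folklore] -/
theorem cochainsMap_coindCounit_comp_iso_hom :
    cochainsMap S.subtype (coindCounit S B) ≫ (inhomogeneousCochainsIso B).hom =
      (inhomogeneousCochainsIso (Rep.coind S.subtype B)).hom ≫
        (linearYonedaObjResProjectiveResolutionIso (Rep.barResolution k G) B).inv ≫
          precompYoneda (R := k) (Rep.barResolution k S) (resBar S) (barInclusion S) B := by
  refine HomologicalComplex.hom_ext _ _ fun i => ?_
  simp only [HomologicalComplex.comp_f]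
  refine ModuleCat.hom_ext (LinearMap.ext fun x => ?_)
  have hIS : (inhomogeneousCochainsIso B).hom.f i =
      (Rep.freeLiftLEquiv k S (Fin i → S) B).toModuleIso.symm.hom := by
    simp only [groupCohomology.inhomogeneousCochainsIso, HomologicalComplex.Hom.isoOfComponents_hom_f]
  have hIG : (inhomogeneousCochainsIso (Rep.coind S.subtype B)).hom.f i =
      (Rep.freeLiftLEquiv k G (Fin i → G) (Rep.coind S.subtype B)).toModuleIso.symm.hom := by
    simp only [groupCohomology.inhomogeneousCochainsIso, HomologicalComplex.Hom.isoOfComponents_hom_f]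
  have hAdj : (linearYonedaObjResProjectiveResolutionIso (Rep.barResolution k G) B).inv.f i =
      (Rep.resCoindHomEquiv S.subtype ((Rep.barResolution k G).complex.X i) B).toModuleIso.inv := by
    simp only [groupCohomology.linearYonedaObjResProjectiveResolutionIso,
      HomologicalComplex.Hom.isoOfComponents_inv_f]
  set eS := Rep.freeLiftLEquiv k S (Fin i → S) B with heS
  set eG := Rep.freeLiftLEquiv k G (Fin i → G) (Rep.coind S.subtype B) with heG
  have happlyS : ∀ (f : Rep.free k S (Fin i → S) ⟶ B) (a : Fin i → S),
      f.hom (single a (MonoidAlgebra.single 1 1)) = eS f a := fun f a => rfl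
  have happlyG : ∀ (f : Rep.free k G (Fin i → G) ⟶ Rep.coind S.subtype B) (a : Fin i → G),
      f.hom (single a (MonoidAlgebra.single 1 1)) = eG f a := fun f a => rfl
  simp only [ModuleCat.hom_comp, LinearMap.comp_apply]
  rw [hIS, hIG, hAdj]
  change eS.symm (((cochainsMap S.subtype (coindCounit S B)).f i).hom x) =
    barInclusionF S i ≫ (Rep.resCoindHomEquiv S.subtype ((Rep.barResolution k G).complex.X i) B).symm (eG.symm x)
  refine Rep.free_ext _ _ _ _ _ fun y => ?_
  change eS (eS.symm (((cochainsMap S.subtype (coindCounit S B)).f i).hom x)) y =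
    ((eG.symm x).hom ((barInclusionF S i).hom (single y (MonoidAlgebra.single (1 : S) (1 : k))))).1 1
  rw [eS.apply_symm_apply, barInclusionF_hom_single_single, OneMemClass.coe_one, happlyG,
    eG.apply_symm_apply]
  rfl

/-- **Mathlib's Shapiro isomorphism is restriction followed by evaluation at `1`**:
`coindIso B n = Hⁿ(S ↪ G, ev₁)`. [cite: Brown1982CohomologyGroups, III (6.2), Ex. III.8.2] -/
theorem coindIso_hom_eq (n : ℕ) :
    (groupCohomology.coindIso B n).hom = groupCohomology.map S.subtype (coindCounit S B) n := by
  -- both sides agree after composing with the isomorphism `Hⁿ(ι_B)`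
  set H : groupCohomology B n ⟶ ((Rep.barComplex k S).linearYonedaObj k B).homology n :=
    HomologicalComplex.homologyMap (inhomogeneousCochainsIso B).hom n with hH
  have hX : (groupCohomologyIso B n (resBar S)).hom ≫
      HomologicalComplex.homologyMap (precompYoneda (R := k) (Rep.barResolution k S) (resBar S)
        (barInclusion S) B) n = H :=
    groupCohomologyIso_resBar_hom_comp S B n
  haveI : IsIso H :=
    (inferInstance : IsIso ((HomologicalComplex.homologyFunctor _ _ n).map (inhomogeneousCochainsIso B).hom))
  refine (cancel_mono H).mp ?_
  have h4 : (groupCohomologyIso B n (resBar S)).inv ≫ H =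
      HomologicalComplex.homologyMap (precompYoneda (R := k) (Rep.barResolution k S) (resBar S)
        (barInclusion S) B) n := (Iso.inv_comp_eq _).mpr hX.symm
  have h1 : groupCohomology.map S.subtype (coindCounit S B) n ≫ H =
      HomologicalComplex.homologyMap (cochainsMap S.subtype (coindCounit S B) ≫
        (inhomogeneousCochainsIso B).hom) n :=
    (HomologicalComplex.homologyMap_comp _ _ n).symm
  rw [h1, cochainsMap_coindCounit_comp_iso_hom]
  have e1 : (groupCohomology.coindIso B n).hom ≫ H =
      HomologicalComplex.homologyMap ((inhomogeneousCochainsIso (Rep.coind S.subtype B)).hom ≫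
          (linearYonedaObjResProjectiveResolutionIso (Rep.barResolution k G) B).inv) n ≫
        ((groupCohomologyIso B n (resBar S)).inv ≫ H) :=
    Category.assoc _ _ _
  have e3 := (HomologicalComplex.homologyMap_comp
    ((inhomogeneousCochainsIso (Rep.coind S.subtype B)).hom ≫
      (linearYonedaObjResProjectiveResolutionIso (Rep.barResolution k G) B).inv)
    (precompYoneda (R := k) (Rep.barResolution k S) (resBar S) (barInclusion S) B) n).symm
  have e4 : ((inhomogeneousCochainsIso (Rep.coind S.subtype B)).hom ≫
      (linearYonedaObjResProjectiveResolutionIso (Rep.barResolution k G) B).inv) ≫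
      precompYoneda (R := k) (Rep.barResolution k S) (resBar S) (barInclusion S) B =
    (inhomogeneousCochainsIso (Rep.coind S.subtype B)).hom ≫
      (linearYonedaObjResProjectiveResolutionIso (Rep.barResolution k G) B).inv ≫
        precompYoneda (R := k) (Rep.barResolution k S) (resBar S) (barInclusion S) B :=
    Category.assoc _ _ _
  exact e1.trans ((congrArg (fun t => HomologicalComplex.homologyMap
    ((inhomogeneousCochainsIso (Rep.coind S.subtype B)).hom ≫
      (linearYonedaObjResProjectiveResolutionIso (Rep.barResolution k G) B).inv) n ≫ t) h4).trans
    (e3.trans (congrArg (fun t => HomologicalComplex.homologyMap t n) e4)))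

/-- **The explicit Shapiro map is an isomorphism.** [cite: Brown1982CohomologyGroups, III (6.2)] -/
theorem isIso_map_subtype_coindCounit (n : ℕ) :
    IsIso (groupCohomology.map S.subtype (coindCounit S B) n) := by
  rw [← coindIso_hom_eq]
  infer_instance

/-- **The explicit Shapiro map is injective.** [cite: Brown1982CohomologyGroups, III (6.2)] -/
theorem map_subtype_coindCounit_injective (n : ℕ) :
    Function.Injective (groupCohomology.map S.subtype (coindCounit S B) n).hom := by
  rw [← coindIso_hom_eq]
  exact (groupCohomology.coindIso B n).toLinearEquiv.injective

/-- **The explicit Shapiro map is bijective.** [cite: Brown1982CohomologyGroups, III (6.2)] -/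
theorem map_subtype_coindCounit_bijective (n : ℕ) :
    Function.Bijective (groupCohomology.map S.subtype (coindCounit S B) n).hom := by
  rw [← coindIso_hom_eq]
  exact (groupCohomology.coindIso B n).toLinearEquiv.bijective

end Bar


end Literature.Algebra.Homology
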